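import Literature.MathematicalPhysics.QuantumLattice.LayeredHeisenbergMerminWagnerCeiling
import Literature.MathematicalPhysics.QuantumLattice.XXZAntiferromagnetThermalSpontaneousOrder
import Literature.MathematicalPhysics.QuantumLattice.AnisotropicHeisenbergThermalNeelOrder
import Literature.MathematicalPhysics.QuantumLattice.AnisotropicHeisenbergThermalInfraredBound
import Literature.MathematicalPhysics.QuantumLattice.HeisenbergModelGlobalRotationProofs
import Mathlib.NumberTheory.Harmonic.Bounds
import HarnessLib

/-!
# The layered Heisenberg antiferromagnet: Mermin–Wagner + Koma–Tasaki give a CEILING on Kennedy–Lieb–Shastry's thermal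
# Néel order parameter `liminf |Λ|⁻² Σ_{x,y}(-1)^{x+y}⟨𝐒_x·𝐒_y⟩_β ≤ 2βS⁴(16ΣK_∥/H_R + 8|K_⊥|R²)`, hence `≤ 320βS⁴/log(1/r)`
# for `K = (1,1,r)` — two-sided with the tree's reflection-positivity FLOOR: `T_N(r) = Θ(1/log(1/r))`

Topic `Literature/MathematicalPhysics/QuantumLattice` (family `hubbard`; sequel of `LayeredHeisenbergMerminWagnerCeiling` (the
Mermin–Wagner ceiling on the SOURCED staggered magnetisation of `heisAnisoTorus L n K = Σ_xΣ_i K_i 𝐒_x·𝐒_{x+e_i}`, uniformly in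
the volume), of `XXZAntiferromagnetThermalSpontaneousOrder` (the Heisenberg antiferromagnet on the torus as a Koma–Tasaki `SU(2)`
system, `XXZKT.afSU2System`, uniform coupling) and of `KomaTasakiGriffithsTheoremSubsequence` (KT93 Theorem 2.1 / Corollary 2.2
WITHOUT the free-energy hypothesis i)); the floors it is compared with are the tree's `layeredHeis_thermalNeelOrderParameter_ge*`,
`layeredHeis_neelLRO_thermal_largeSpin` (`AnisotropicHeisenbergThermalNeelOrder`, reflection positivity)).

THE QUESTION. `LayeredHeisenbergMerminWagnerCeiling` bounds the staggered magnetisation that a staggered FIELD induces; the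
tree's reflection-positivity floors concern the ZERO-FIELD long-range order functional
`σ²_Λ = |Λ|⁻² Σ_{x,y}(-1)^{x+y}⟨𝐒_x·𝐒_y⟩_{β,Λ}` ([KLS1988JSP] (7), [DLS1978]). Koma and Tasaki's theorem [cite: KomaTasaki1993,
Theorem 2.1, Corollary 2.2] is exactly the bridge "long-range order ⟹ sourced order parameter" (`m_s ≥ √3 σ` for `SU(2)`), so
Mermin–Wagner's ceiling on the sourced magnetisation is ALSO a ceiling on `liminf_Λ σ²_Λ`. This file carries that out for the
antiferromagnet with direction-dependent couplings and obtains, for Kennedy–Lieb–Shastry's layered model `K = (1, 1, r)`, the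
two-sided statement: `S(S+1) − 9S/√2 − 3C(r)/(2β) ≤ liminf σ²_Λ ≤ 320 β S⁴/log(1/r)` (`0 < r < 1`; `C(r) ≤ 3 + log(1/r)`), i.e.
Néel order at inverse temperature `β` requires `β ≳ log(1/r)/S⁴` (this file) and holds once `β ≳ log(1/r)/S²` (large `S`,
the tree): the Néel temperature of weakly coupled Heisenberg layers is `Θ(J/log(J/J_⊥))` by theorems on both sides.

## Contents (everything PROVED, standard axioms; two plumbing definitions, no named fact)

* §K1 **`XXZKT.anisoAfSU2System d L n K`** — `H_K` on `(ℤ/Lℤ)^d` as a Koma–Tasaki `SU(2)` system (KT93 §2 (2.14)–(2.17),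
  i)–vi)): local Hamiltonians `XXZKT.anisoLocalHam` (`h_x = Σ_i K_i 𝐒_x·𝐒_{x+e_i}`, the forward bonds; `Σ_x h_x = H_K` for
  `L ≥ 3`, `sum_anisoLocalHam`), `‖h_x‖ ≤ h̄_K = (Σ_i|K_i|)·3s²` (`XXZKT.anisoHbar`, `norm_anisoLocalHam_le`), locality off the
  forward neighbourhood `XXZKT.anisoNbhd` (`|S(x)| ≤ d+1`), invariance under the half turn (`halfTurn_conj_spinDot`,
  `halfTurn_conj_sum_anisoLocalHam`) and under `SU(2)` (`commute_sum_anisoLocalHam_totalSpin`); order densities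
  `o^{(i)}_x = (-1)^xS^i_x`, generators `S^j_tot`, as in the tree's `afSU2System`. Dictionary: `anisoAfSU2System_hamiltonian`
  (`= heisAnisoTorus L n K`, `L ≥ 3`), `_order` (`= Σ_x(-1)^xSˣ_x`), `_magnetisation`, `_moment_one`
  (`= |Λ|⁻² Σ_{x,y}(-1)^{x+y} gibbsSpinCorr β H_K 0 x y`). Also `XXZKT.inv_card_mul_re_stagSpin_le_sqrt` (the staggered
  magnetisation per site is at most the largest one-point function).
* §K2 **`XXZKT.anisoHeis_thermal_stagMagnetisation_ge_of_eventually_sq_le`** — KT93 Corollary 2.2 for `H_K`, every `d ≥ 1`,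
  every `K`, every `β > 0`, hypothesis i) removed: an eventual floor `σ² ≤ |Λ|⁻²Σ(-1)^{x+y}Re⟨Sˣ_xSˣ_y⟩_{β,H_K}` along the even tori
  forces `√3σ − ε ≤ |Λ|⁻¹Re⟨O_Λ⟩_{β,H_K−B·O_Λ}` eventually, for every `B, ε > 0` (the tree's
  `SU2System.le_sqrt_three_mul_magnetisation_add_of_eventually_moment_one`).
* §K3 **THE CEILINGS** (layers `(ℤ/(2k+2)ℤ)^{m+1}`, `m ∈ {1,2}`, in-plane `K_j`, interlayer `K_m`, every spin `S = n/2`,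
  `β > 0`, `R ≥ 1`, `H_R = Σ_{k<R}1/(k+1)`):
  `layeredHeis_thermalNeelOrderParameter_liminf_le`:
  `liminf_k |Λ|⁻² Σ_{x,y}(-1)^{x+y}Σ_α Re⟨S^α_xS^α_y⟩_{β,H_K} ≤ β S²·2S²(16(Σ_{j<m}|K_j|)/H_R + 8|K_m|R²)`;
  `…_three` (`K = (K₀,K₁,K_⊥)`); `layeredHeis_thermalNeelOrderParameter_two_sided` (`K = (1,1,r)`, `0 < r ≤ 1`: the tree's floor
  `S(S+1) − 9S/√2 − 3C(r)/(2β) ≤ liminf` AND `liminf ≤ 2βS⁴(32/H_R + 8rR²)`);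
  `layeredHeis_thermalNeelOrderParameter_liminf_le_log` (`0 < r < 1`: `liminf ≤ 320βS⁴/log(1/r)`, scale `R = ⌊(1/r)^{1/4}⌋`).

Proof of §K3 (as printed nowhere in one place; the three ingredients are [MerminWagner1966], [KomaTasaki1993 Cor. 2.2] and
isotropy [KLS1988JSP p. 1021]): if `liminf > c` then eventually the functional exceeds `(c+liminf)/2 = 3σ²`; by isotropy
(`gibbsSpinCorr_anisoHeis_eq_zero_comp`) the `Sˣ` moment exceeds `σ²`; §K2 gives `√3σ − ε ≤ m_Λ(B)` eventually; the sourced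
Mermin–Wagner bound (`sq_re_gibbsState_siteSpin_le_layeredHeis`, every site, uniformly in `Λ`) gives `m_Λ(B) ≤ √(c + c'B)`;
`ε, B → 0` yield `3σ² ≤ c`, a contradiction.

WHAT THIS IS NOT: the constants are Mermin–Wagner-lossy (`320 S⁴` above against `~S²` below: the window in `β` is a factor
`~S²·const` wide); nothing about the ground state (`β = ∞`), where a single layer IS expected to order; nothing about the Hubbard
model. The floor side is the tree's, restated only inside `…_two_sided`.

## Mathlib / tree search

REUSED: `KomaTasaki.SU2System`, `KomaTasaki.Z2System.{hamiltonian, order, magnetisation, moment, moment_nonneg}`,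
`KomaTasaki.SU2System.le_sqrt_three_mul_magnetisation_add_of_eventually_moment_one` (`KomaTasakiGriffithsTheorem(Subsequence)`);
`XXZKT.{sNorm, one_le_sNorm, norm_spinBond_le, halfTurn, halfTurn_conj, quarterTurn, halfTurn_mul_conjTranspose,
halfTurn_conj_siteSpin_zero/one, stagSign, abs_stagSign, stagSpin, torusParityExp, isHermitian_stagSign_smul_siteSpin,
norm_stagSign_smul_siteSpin_le, halfTurn_conj_stagSpin_zero, sum_equivFin_stagSign_smul_siteSpin, totalSpin_comm_stagSpin,
commute_stagSign_smul_siteSpin, totalSpin_comm_totalSpin, tendsto_card_torusSite_two_mul_add_two, log_card_config_le}`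
(`XXZ(Antiferromagnet)ThermalSpontaneousOrder`); `quarterTurn_conj_siteSpin_two` (`XYOrderDischarges`); `commute_spinDot_totalSpin`
(`HeisenbergModelGlobalRotationProofs`); `spinDot`, `spinDot_isHermitian`, `siteSpin_commute_of_ne_holds`, `totalSpin_isHermitian`;
`heisAnisoTorus_eq_sum` (`AnisotropicHeisenbergGaussianDomination`); `gibbsSpinCorr`, `gibbsSpinCorr_anisoHeis_eq_zero_comp`
(`AnisotropicHeisenbergThermalInfraredBound`); `layeredHeis_thermalNeelOrderParameter_ge`, `AnisotropicRotator.klsConstant`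
(`AnisotropicHeisenbergThermalNeelOrder`); `sq_re_gibbsState_siteSpin_le_layeredHeis` (`LayeredHeisenbergMerminWagnerCeiling`);
`one_le_sum_range_one_div_succ`; Mathlib `log_add_one_le_harmonic`, `Filter.eventually_lt_of_lt_liminf`, `Real.abs_le_sqrt`,
`mul_eq_one_comm`, `Nat.floor_pos`, `Nat.lt_floor_add_one`, `Real.log_sqrt`.
`lean search 'anisoAfSU2System|NeelOrderParameter_liminf_le|NeelOrderParameter.*ceiling'` (2026-08-29): nothing — the tree's
`layeredHeis_*` are floors; its KT systems (`afZ2System`, `afSU2System`, `DWaveKT`, `KomaPiFlux…`) have uniform couplings.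

## References

* N. D. Mermin, H. Wagner, Phys. Rev. Lett. 17 (1966) 1133–1136. [cite: MerminWagnerPRL1966, pp. 1133–1135]
* T. Koma, H. Tasaki, Commun. Math. Phys. 158 (1993) 191–214, §1 (1.1)–(1.8), §2 (2.1)–(2.17), Thm. 2.1, Cor. 2.2.
  [cite: KomaTasaki1993, §1–§2, Theorem 2.1, Corollary 2.2]
* T. Kennedy, E. H. Lieb, B. S. Shastry, J. Stat. Phys. 53 (1988) 1019–1030, p. 1020–1021, eqs. (5), (7).
  [cite: KLS1988JSP, eqs. (5), (7)]
* F. J. Dyson, E. H. Lieb, B. Simon, J. Stat. Phys. 18 (1978) 335–383, Thm. 6.2. [cite: DLS1978, Thm. 6.2]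
* A. Klein, L. J. Landau, D. S. Shucker, J. Stat. Phys. 26 (1981) 505–512. [cite: KleinLandauShucker1981]
* H. Tasaki, Physics and Mathematics of Quantum Many-Body Systems (2020), §2.2, §2.4–2.5. [cite: Tasaki2020, §2.2–§2.5]
-/

noncomputable section

namespace Literature.MathematicalPhysics.QuantumLattice

open Finset _root_.Matrix Complex _root_.Filter Literature.Probability.LatticeModels
  Literature.MathematicalPhysics.QuantumLattice.SpinOperators
open scoped ComplexOrder MatrixOrder _root_.Topology _root_.Matrix.Norms.L2Operator

/-! ### §K0 Two scalar facts -/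

section ScalarAux

/-- `log(R+1) ≤ Σ_{k<R} 1/(k+1)` (Mathlib's `log_add_one_le_harmonic`). [folklore] -/
private theorem log_succ_le_harmonicSum_neel (R : ℕ) : Real.log ((R : ℝ) + 1) ≤ ∑ k ∈ range R, (1 : ℝ) / (k + 1) := by
  have h := log_add_one_le_harmonic R
  have e : ((harmonic R : ℚ) : ℝ) = ∑ k ∈ range R, (1 : ℝ) / (k + 1) := by
    simp only [harmonic, Rat.cast_sum, Rat.cast_inv, Rat.cast_add, Rat.cast_one, Rat.cast_natCast, Nat.cast_add,
      Nat.cast_one, one_div]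
  rw [e] at h
  exact_mod_cast h

/-- `|Λ| = L^d`. [folklore] -/
private theorem card_torusSite_neel (d L : ℕ) [NeZero L] : Fintype.card (TorusSite d L) = L ^ d := by
  rw [Fintype.card_pi, prod_const, ZMod.card, card_univ, Fintype.card_fin]

end ScalarAux

/-! ### §K1 The Heisenberg antiferromagnet with direction-dependent couplings as a Koma–Tasaki `SU(2)` system -/

namespace XXZKT

section AnisoGraph

variable {Λ : Type*} [Fintype Λ] [DecidableEq Λ] (n : ℕ)

/-- `‖𝐒_x·𝐒_y‖ ≤ 3s²` (`s = S + 1`). [cite: KomaTasaki1993, §2 ii)] -/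
theorem norm_spinDot_le_sNorm (x y : Λ) : ‖(spinDot n x y : Op Λ (n + 1))‖ ≤ 3 * sNorm n ^ 2 := by
  rw [spinDot]
  refine (norm_sum_le _ _).trans ?_
  calc ∑ α : Fin 3, ‖(spinBond n α x y : Op Λ (n + 1))‖ ≤ ∑ _α : Fin 3, sNorm n ^ 2 :=
        sum_le_sum fun α _ => norm_spinBond_le n α x y
    _ = 3 * sNorm n ^ 2 := by rw [sum_const, card_univ, Fintype.card_fin, nsmul_eq_mul, Nat.cast_ofNat]

/-- `Uᴴ U = 1` for the half turn about the `3`-axis. [cite: KomaTasaki1993, §2 (U_Λ unitary)] -/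
private theorem halfTurn_conjTranspose_mul_self : (halfTurn (Λ := Λ) n)ᴴ * halfTurn n = 1 :=
  mul_eq_one_comm.1 (halfTurn_mul_conjTranspose n)

/-- Conjugation by the half turn is multiplicative. [cite: KomaTasaki1993, §2 (2.3)] -/
theorem halfTurn_conj_mul (A B : Op Λ (n + 1)) :
    halfTurn n * (A * B) * (halfTurn n)ᴴ = halfTurn n * A * (halfTurn n)ᴴ * (halfTurn n * B * (halfTurn n)ᴴ) := by
  have hU := halfTurn_conjTranspose_mul_self (Λ := Λ) n
  calc halfTurn n * (A * B) * (halfTurn n)ᴴ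
      = halfTurn n * A * ((halfTurn n)ᴴ * halfTurn n) * B * (halfTurn n)ᴴ := by
        rw [hU, Matrix.mul_one, Matrix.mul_assoc (halfTurn n) A B]
    _ = _ := by simp only [Matrix.mul_assoc]

/-- `U Sᶻ_x Uᴴ = Sᶻ_x` (the half turn about the `3`-axis fixes `Sᶻ`). [cite: KomaTasaki1993, §2 (2.3)]
[cite: Tasaki2020, §2.2 eq. (2.2.12)] -/
theorem halfTurn_conj_siteSpin_two (x : Λ) :
    halfTurn n * siteSpin n x 2 * (halfTurn n)ᴴ = (siteSpin n x 2 : Op Λ (n + 1)) := by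
  rw [halfTurn_conj, quarterTurn, quarterTurn_conj_siteSpin_two, quarterTurn_conj_siteSpin_two]

/-- `U (S^α_x S^α_y) Uᴴ = S^α_x S^α_y` for every component (two sign flips or none). [cite: KomaTasaki1993, §2 (2.3)] -/
theorem halfTurn_conj_siteSpin_mul_siteSpin (x y : Λ) (α : Fin 3) :
    halfTurn n * (siteSpin n x α * siteSpin n y α) * (halfTurn n)ᴴ = (siteSpin n x α * siteSpin n y α : Op Λ (n + 1)) := by
  rw [halfTurn_conj_mul]
  fin_cases α
  · simp only [Fin.zero_eta, Fin.isValue]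
    rw [halfTurn_conj_siteSpin_zero, halfTurn_conj_siteSpin_zero, neg_mul_neg]
  · simp only [Fin.mk_one, Fin.isValue]
    rw [halfTurn_conj_siteSpin_one, halfTurn_conj_siteSpin_one, neg_mul_neg]
  · simp only [Fin.reduceFinMk, Fin.isValue]
    rw [halfTurn_conj_siteSpin_two, halfTurn_conj_siteSpin_two]

/-- **`U (𝐒_x·𝐒_y) Uᴴ = 𝐒_x·𝐒_y`**: the Heisenberg bond is invariant under the half turn (KT93 (2.3) bondwise).
[cite: KomaTasaki1993, §2 (2.3)] [cite: Tasaki2020, §2.4] -/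
theorem halfTurn_conj_spinDot (x y : Λ) :
    halfTurn n * spinDot n x y * (halfTurn n)ᴴ = (spinDot n x y : Op Λ (n + 1)) := by
  simp only [spinDot, spinBond, Finset.mul_sum, Finset.sum_mul, Matrix.mul_smul, Matrix.smul_mul, Matrix.mul_add,
    Matrix.add_mul, halfTurn_conj_siteSpin_mul_siteSpin]

/-- The staggered magnetisation per site of a state is at most its largest one-point function:
`|Λ|⁻¹ Re ρ(O^{(1)}) ≤ √M` if `(Re ρ(Sˣ_x))² ≤ M` for all `x`. [cite: KomaTasaki1993, §1 (1.4)] -/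
theorem inv_card_mul_re_stagSpin_le_sqrt (σ : Λ → ℕ) (ρ : Op Λ (n + 1) →ₗ[ℂ] ℂ) {M : ℝ}
    (h : ∀ x, (ρ (siteSpin n x 0)).re ^ 2 ≤ M) :
    (Fintype.card Λ : ℝ)⁻¹ * (ρ (stagSpin n σ 0)).re ≤ Real.sqrt M := by
  have hx : ∀ x, stagSign σ x * (ρ (siteSpin n x 0)).re ≤ Real.sqrt M := fun x => by
    have h1 : |(ρ (siteSpin n x 0)).re| ≤ Real.sqrt M := Real.abs_le_sqrt (h x)
    have h2 : |stagSign σ x * (ρ (siteSpin n x 0)).re| ≤ Real.sqrt M := by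
      rw [abs_mul, abs_stagSign, one_mul]; exact h1
    exact (le_abs_self _).trans h2
  have hsum : (ρ (stagSpin n σ 0)).re = ∑ x, stagSign σ x * (ρ (siteSpin n x 0)).re := by
    rw [stagSpin, map_sum, Complex.re_sum]
    refine sum_congr rfl fun x _ => ?_
    rw [map_smul, smul_eq_mul, Complex.re_ofReal_mul]
  rw [hsum]
  have hle : ∑ x, stagSign σ x * (ρ (siteSpin n x 0)).re ≤ (Fintype.card Λ : ℝ) * Real.sqrt M := by
    refine (sum_le_sum fun x _ => hx x).trans ?_
    rw [sum_const, card_univ, nsmul_eq_mul]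
  by_cases hc : (Fintype.card Λ : ℝ) = 0
  · rw [hc, _root_.inv_zero, zero_mul]; exact Real.sqrt_nonneg _
  · calc (Fintype.card Λ : ℝ)⁻¹ * ∑ x, stagSign σ x * (ρ (siteSpin n x 0)).re
        ≤ (Fintype.card Λ : ℝ)⁻¹ * ((Fintype.card Λ : ℝ) * Real.sqrt M) :=
          mul_le_mul_of_nonneg_left hle (inv_nonneg.2 (Nat.cast_nonneg _))
      _ = Real.sqrt M := by rw [← mul_assoc, inv_mul_cancel₀ hc, one_mul]

end AnisoGraph

section AnisoTorus

variable (d L n : ℕ) [NeZero L]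

/-- **The local Hamiltonian of the antiferromagnet with direction-dependent couplings** ([KLS1988JSP] (5)): the
`d` forward bonds out of `x`, `h_x = Σ_i K_i 𝐒_x·𝐒_{x+e_i}`, so that `Σ_x h_x = H_K` on a torus of side `≥ 3`.
[cite: KLS1988JSP, eq. (5)] [cite: KomaTasaki1993, §2 (2.2)] -/
def anisoLocalHam (K : Fin d → ℝ) (x : TorusSite d L) : Op (TorusSite d L) (n + 1) :=
  ∑ i : Fin d, ((K i : ℝ) : ℂ) • spinDot n x (x + Pi.single i 1)

/-- **`Σ_x h_x = H_K`** (`L ≥ 3`). [cite: KLS1988JSP, eq. (5)] [cite: KomaTasaki1993, §2 (2.2)] -/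
theorem sum_anisoLocalHam (hL3 : 3 ≤ L) (K : Fin d → ℝ) :
    ∑ x, anisoLocalHam d L n K x = heisAnisoTorus L n K :=
  (heisAnisoTorus_eq_sum L n hL3 K).symm

/-- `h_x` is Hermitian. [cite: KomaTasaki1993, §2 (2.2)] -/
theorem isHermitian_anisoLocalHam (K : Fin d → ℝ) (x : TorusSite d L) : (anisoLocalHam d L n K x).IsHermitian :=
  (isSelfAdjoint_sum univ fun i _ =>
    ((spinDot_isHermitian n x (x + Pi.single i 1)).smul
      (by rw [isSelfAdjoint_iff, Complex.star_def, Complex.conj_ofReal])).isSelfAdjoint).isHermitian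

/-- The uniform bound `h̄_K = (Σ_i |K_i|)·3s²` on the local Hamiltonians (KT93 ii)). [cite: KomaTasaki1993, §2 ii)] -/
def anisoHbar (d n : ℕ) (K : Fin d → ℝ) : ℝ := (∑ i, |K i|) * (3 * sNorm n ^ 2)

/-- ii): `‖h_x‖ ≤ h̄_K`. [cite: KomaTasaki1993, §2 ii)] -/
theorem norm_anisoLocalHam_le (K : Fin d → ℝ) (x : TorusSite d L) : ‖anisoLocalHam d L n K x‖ ≤ anisoHbar d n K := by
  unfold anisoLocalHam anisoHbar
  refine (norm_sum_le _ _).trans ?_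
  rw [Finset.sum_mul]
  refine sum_le_sum fun i _ => ?_
  rw [norm_smul, Complex.norm_real, Real.norm_eq_abs]
  exact mul_le_mul_of_nonneg_left (norm_spinDot_le_sNorm n x _) (abs_nonneg _)

omit [NeZero L] in
/-- The forward neighbourhood `S(x) = {x} ∪ {x + e_i}` of iii). [cite: KomaTasaki1993, §2 iii)] -/
def anisoNbhd (x : TorusSite d L) : Finset (TorusSite d L) :=
  insert x (univ.image fun i : Fin d => x + Pi.single i 1)

omit [NeZero L] in
/-- `|S(x)| ≤ d + 1`. [cite: KomaTasaki1993, §2 iii)] -/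
theorem card_anisoNbhd_le (x : TorusSite d L) : (anisoNbhd d L x).card ≤ d + 1 := by
  unfold anisoNbhd
  refine (card_insert_le _ _).trans ?_
  have h := card_image_le (s := (univ : Finset (Fin d))) (f := fun i : Fin d => x + Pi.single i 1)
  rw [card_univ, Fintype.card_fin] at h
  omega

/-- iii) LOCALITY: `h_x` commutes with every spin component at a site off `S(x)`. [cite: KomaTasaki1993, §2 iii)] -/
theorem commute_anisoLocalHam_siteSpin (K : Fin d → ℝ) {x y : TorusSite d L} (hy : y ∉ anisoNbhd d L x) (b : Fin 3) :
    Commute (anisoLocalHam d L n K x) (siteSpin n y b) := by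
  have hyx : y ≠ x := fun h => hy (h ▸ mem_insert_self _ _)
  have hyi : ∀ i : Fin d, y ≠ x + Pi.single i 1 := fun i h =>
    hy (mem_insert_of_mem (mem_image.2 ⟨i, mem_univ _, h.symm⟩))
  unfold anisoLocalHam
  refine Commute.sum_left _ _ _ fun i _ => Commute.smul_left ?_ _
  rw [spinDot]
  refine Commute.sum_left _ _ _ fun α _ => ?_
  rw [spinBond]
  refine Commute.smul_left (Commute.add_left ?_ ?_) _
  · exact (siteSpin_commute_of_ne_holds n hyx.symm α b).mul_left (siteSpin_commute_of_ne_holds n (hyi i).symm α b)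
  · exact (siteSpin_commute_of_ne_holds n (hyi i).symm α b).mul_left (siteSpin_commute_of_ne_holds n hyx.symm α b)

/-- (2.3): `U (Σ_x h_x) Uᴴ = Σ_x h_x`. [cite: KomaTasaki1993, §2 (2.3)] -/
theorem halfTurn_conj_sum_anisoLocalHam (K : Fin d → ℝ) :
    halfTurn n * (∑ x, anisoLocalHam d L n K x) * (halfTurn n)ᴴ = ∑ x, anisoLocalHam d L n K x := by
  simp only [anisoLocalHam, Finset.mul_sum, Finset.sum_mul, Matrix.mul_smul, Matrix.smul_mul, halfTurn_conj_spinDot]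

/-- vi) (2.17): `[Σ_x h_x, S^j_tot] = 0` (`SU(2)` invariance of every bond `𝐒_x·𝐒_y`). [cite: KomaTasaki1993, (2.17)]
[cite: Tasaki2020, §2.5 eq. (2.5.2)] -/
theorem commute_sum_anisoLocalHam_totalSpin (K : Fin d → ℝ) (j : Fin 3) :
    Commute (∑ x, anisoLocalHam d L n K x) (totalSpin n j) :=
  Commute.sum_left _ _ _ fun x _ => Commute.sum_left _ _ _ fun _ _ => (commute_spinDot_totalSpin n x _ j).smul_left _

/-- **THE ANTIFERROMAGNET WITH DIRECTION-DEPENDENT COUPLINGS `H_K = Σ_xΣ_i K_i 𝐒_x·𝐒_{x+e_i}` ON THE TORUS AS A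
KOMA–TASAKI `SU(2)` SYSTEM** (KT93 §2 (2.14)–(2.17), i)–vi)): `h_x = Σ_i K_i 𝐒_x·𝐒_{x+e_i}`, `o^{(i)}_x = (-1)^xS^i_x`,
`X^{(j)} = S^j_tot`, `U_Λ` the half turn about the `3`-axis, `S(x) = {x, x+e_i}`, `h̄ = (Σ|K_i|)·3s²`, `ō = s`,
`r = 2d+2`. For `K ≡ J` it is (a re-bracketing of) the tree's `afSU2System`. [cite: KomaTasaki1993, §2 (2.14)–(2.17), i)–vi)]
[cite: KLS1988JSP, eq. (5)] -/
def anisoAfSU2System (K : Fin d → ℝ) :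
    KomaTasaki.SU2System (Fintype.card (TorusSite d L)) (anisoHbar d n K) (sNorm n) (2 * d + 2)
      (TorusSite d L → Fin (n + 1)) where
  h i := anisoLocalHam d L n K ((Fintype.equivFin (TorusSite d L)).symm i)
  o k i := (stagSign (torusParityExp d L) ((Fintype.equivFin (TorusSite d L)).symm i) : ℂ) •
    siteSpin n ((Fintype.equivFin (TorusSite d L)).symm i) k
  X j := totalSpin n j
  U := halfTurn n
  supp _ i := (anisoNbhd d L ((Fintype.equivFin (TorusSite d L)).symm i)).map (Fintype.equivFin (TorusSite d L)).toEmbedding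
  isHermitian_h i := isHermitian_anisoLocalHam d L n K _
  isHermitian_o k i := isHermitian_stagSign_smul_siteSpin n _ _ k
  isHermitian_X j := totalSpin_isHermitian n j
  U_mul_conjTranspose := halfTurn_mul_conjTranspose n
  conj_hamiltonian := by
    rw [(Fintype.equivFin (TorusSite d L)).symm.sum_comp (fun y => anisoLocalHam d L n K y)]
    exact halfTurn_conj_sum_anisoLocalHam d L n K
  conj_order := by
    rw [sum_equivFin_stagSign_smul_siteSpin]
    exact halfTurn_conj_stagSpin_zero n (torusParityExp d L)
  norm_h_le i := norm_anisoLocalHam_le d L n K _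
  norm_o_le k i := norm_stagSign_smul_siteSpin_le n _ _ k
  commute_h_o k i j hj := by
    have hj' : (Fintype.equivFin (TorusSite d L)).symm j ∉ anisoNbhd d L ((Fintype.equivFin (TorusSite d L)).symm i) := by
      rwa [Finset.mem_map_equiv] at hj
    exact (commute_anisoLocalHam_siteSpin d L n K hj' k).smul_right _
  card_supp_le _ i := by
    rw [Finset.card_map]
    exact (card_anisoNbhd_le d L _).trans (by omega)
  two_le_r := by omega
  commute_o_o k k' i j hij :=
    commute_stagSign_smul_siteSpin n _
      (fun h => hij ((Fintype.equivFin (TorusSite d L)).symm.injective h)) k k'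
  X_comm j k := totalSpin_comm_totalSpin n j k
  X_order j k := by
    simp only [sum_equivFin_stagSign_smul_siteSpin]
    exact totalSpin_comm_stagSpin n (torusParityExp d L) j k
  commute_hamiltonian_X j := by
    rw [(Fintype.equivFin (TorusSite d L)).symm.sum_comp (fun y => anisoLocalHam d L n K y)]
    exact commute_sum_anisoLocalHam_totalSpin d L n K j

/-! #### Dictionary -/

/-- `H_Λ = H_K` (`L ≥ 3`). [cite: KomaTasaki1993, §2 (2.2)] -/
theorem anisoAfSU2System_hamiltonian (hL3 : 3 ≤ L) (K : Fin d → ℝ) :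
    (anisoAfSU2System d L n K).toZ2System.hamiltonian = heisAnisoTorus L n K := by
  rw [KomaTasaki.Z2System.hamiltonian]
  change ∑ i, anisoLocalHam d L n K ((Fintype.equivFin (TorusSite d L)).symm i) = _
  rw [(Fintype.equivFin (TorusSite d L)).symm.sum_comp (fun y => anisoLocalHam d L n K y), sum_anisoLocalHam d L n hL3]

/-- `O_Λ = Σ_x(-1)^xSˣ_x`. [cite: KomaTasaki1993, §1 (1.2), §2 (2.4)] -/
theorem anisoAfSU2System_order (K : Fin d → ℝ) :
    (anisoAfSU2System d L n K).toZ2System.order = (stagSpin n (torusParityExp d L) 0 : Op (TorusSite d L) (n + 1)) := by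
  rw [KomaTasaki.Z2System.order]
  change ∑ i, ((stagSign (torusParityExp d L) ((Fintype.equivFin (TorusSite d L)).symm i) : ℂ) •
    siteSpin n ((Fintype.equivFin (TorusSite d L)).symm i) 0 : Op (TorusSite d L) (n + 1)) = _
  rw [sum_equivFin_stagSign_smul_siteSpin]

/-- `m_Λ(B) = |Λ|⁻¹ Re⟨O_Λ⟩_{β, H_K − B·O_Λ}` (`L ≥ 3`). [cite: KomaTasaki1993, §1 (1.3)–(1.4), §2 (2.9)] -/
theorem anisoAfSU2System_magnetisation (hL3 : 3 ≤ L) (K : Fin d → ℝ) (β B : ℝ) :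
    (anisoAfSU2System d L n K).toZ2System.magnetisation β B =
      (Fintype.card (TorusSite d L) : ℝ)⁻¹ *
        (gibbsState β (heisAnisoTorus L n K - (B : ℂ) • stagSpin n (torusParityExp d L) 0)
          (stagSpin n (torusParityExp d L) 0)).re := by
  rw [KomaTasaki.Z2System.magnetisation, KomaTasaki.Z2System.fieldHamiltonian, anisoAfSU2System_hamiltonian d L n hL3,
    anisoAfSU2System_order]

/-- **`N⁻²⟨O_Λ²⟩_Λ(0) = |Λ|⁻² Σ_{x,y} (-1)^x(-1)^y Re⟨Sˣ_xSˣ_y⟩_{β, H_K}`** (`L ≥ 3`): the symmetric second moment is the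
staggered long-range order quantity of `gibbsSpinCorr β H_K 0`. [cite: KomaTasaki1993, §1 (1.7), §2 (2.12)] -/
theorem anisoAfSU2System_moment_one (hL3 : 3 ≤ L) (K : Fin d → ℝ) (β : ℝ) :
    (anisoAfSU2System d L n K).toZ2System.moment β 1 =
      (∑ x : TorusSite d L, ∑ y : TorusSite d L,
          (-1 : ℝ) ^ (∑ i, (x i).val) * (-1) ^ (∑ i, (y i).val) * gibbsSpinCorr β (heisAnisoTorus L n K) 0 x y) /
        (Fintype.card (TorusSite d L) : ℝ) ^ 2 := by
  rw [KomaTasaki.Z2System.moment, anisoAfSU2System_hamiltonian d L n hL3, anisoAfSU2System_order, mul_one, div_eq_inv_mul]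
  congr 1
  rw [pow_two, stagSpin, Finset.sum_mul_sum, map_sum, Complex.re_sum]
  refine Finset.sum_congr rfl fun x _ => ?_
  rw [map_sum, Complex.re_sum]
  refine Finset.sum_congr rfl fun y _ => ?_
  rw [Matrix.smul_mul, Matrix.mul_smul, smul_smul, map_smul, smul_eq_mul, ← Complex.ofReal_mul,
    Complex.re_ofReal_mul, gibbsSpinCorr, stagSign, stagSign, torusParityExp, torusParityExp]

end AnisoTorus

/-! ### §K2 Koma–Tasaki's floor for the antiferromagnet with direction-dependent couplings (every `d ≥ 1`, every `K`) -/

section AnisoThermal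

variable {d : ℕ}

/-- **KT93 Corollary 2.2 FOR `H_K` (every `d ≥ 1`, every coupling vector `K`, every `β > 0`, hypothesis i) removed):**
an eventual floor `σ² ≤ |Λ|⁻² Σ_{x,y}(-1)^{x+y} Re⟨Sˣ_xSˣ_y⟩_{β,H_K}` (`σ ≥ 0`) along the even tori `(ℤ/(2k+2)ℤ)^d` forces,
for every staggered field `B > 0` and `ε > 0`, eventually `√3 σ − ε ≤ |Λ|⁻¹ Re⟨O_Λ⟩_{β, H_K − B·O_Λ}`, `O_Λ = Σ_x(-1)^xSˣ_x`.
[cite: KomaTasaki1993, Corollary 2.2 (2.18), Theorem 2.1 (2.13), §1 (1.4)–(1.8)] [cite: KLS1988JSP, eq. (5)] -/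
theorem anisoHeis_thermal_stagMagnetisation_ge_of_eventually_sq_le (hd : 1 ≤ d) {n : ℕ} (K : Fin d → ℝ) {β : ℝ}
    (hβ : 0 < β) {σ : ℝ} (hσ : 0 ≤ σ)
    (hLRO : ∀ᶠ k : ℕ in atTop, σ ^ 2 ≤
      (∑ x : TorusSite d (2 * k + 2), ∑ y : TorusSite d (2 * k + 2),
          (-1 : ℝ) ^ (∑ i, (x i).val) * (-1) ^ (∑ i, (y i).val) *
            gibbsSpinCorr β (heisAnisoTorus (2 * k + 2) n K) 0 x y) / ((2 * k + 2 : ℕ) : ℝ) ^ (2 * d))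
    {B : ℝ} (hB : 0 < B) {ε : ℝ} (hε : 0 < ε) :
    ∀ᶠ k : ℕ in atTop, Real.sqrt 3 * σ - ε ≤ (Fintype.card (TorusSite d (2 * k + 2)) : ℝ)⁻¹ *
      (gibbsState β (heisAnisoTorus (2 * k + 2) n K - (B : ℂ) • stagSpin n (torusParityExp d (2 * k + 2)) 0)
        (stagSpin n (torusParityExp d (2 * k + 2)) 0)).re := by
  have hLRO' : ∀ᶠ k : ℕ in atTop, σ ^ 2 ≤ (anisoAfSU2System d (2 * k + 2) n K).toZ2System.moment β 1 := by
    filter_upwards [hLRO, eventually_ge_atTop 1] with k hk hk1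
    rw [anisoAfSU2System_moment_one d (2 * k + 2) n (by omega) K β, card_torusSite_neel, Nat.cast_pow, ← pow_mul,
      mul_comm d 2]
    exact hk
  have hev := KomaTasaki.SU2System.le_sqrt_three_mul_magnetisation_add_of_eventually_moment_one
    (fun k => anisoAfSU2System d (2 * k + 2) n K) (zero_le_one.trans (one_le_sNorm n)) hβ
    (tendsto_card_torusSite_two_mul_add_two hd) (fun k => log_card_config_le d (2 * k + 2) n) hσ hLRO' hB hε
  filter_upwards [hev, eventually_ge_atTop 1] with k hk hk1
  rw [anisoAfSU2System_magnetisation d (2 * k + 2) n (by omega)] at hk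
  linarith

end AnisoThermal

end XXZKT

/-! ### §K3 THE CEILING ON THE THERMAL NÉEL ORDER PARAMETER OF THE LAYERED HEISENBERG ANTIFERROMAGNET -/

section NeelCeiling

variable {m : ℕ}

/-- **MERMIN–WAGNER + KOMA–TASAKI: A CEILING ON THE THERMAL NÉEL ORDER PARAMETER OF WEAKLY COUPLED HEISENBERG LAYERS,
IN THE SYMMETRIC (ZERO-FIELD) GIBBS STATES.** On the even tori `(ℤ/(2k+2)ℤ)^{m+1}`, `m ∈ {1,2}`, for
`H_K = Σ_xΣ_i K_i 𝐒_x·𝐒_{x+e_i}` (in-plane `K_j`, `j < m`; interlayer `K_m`), every spin, every `β > 0` and every `R ≥ 1`: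
`liminf_k |Λ|⁻² Σ_{x,y}(-1)^{x+y} Σ_α Re⟨S^α_xS^α_y⟩_{β,H_K} ≤ β S²·2S²(16 (Σ_{j<m}|K_j|)/H_R + 8|K_m|R²)` — Kennedy–Lieb–Shastry's
Néel order parameter (the quantity the tree's reflection-positivity FLOORS `layeredHeis_thermalNeelOrderParameter_ge*` bound
from below) is bounded ABOVE by the Mermin–Wagner cost. Proof: an eventual floor `3σ²` on the functional is a floor `σ²` on
the `Sˣ` moment (isotropy, `gibbsSpinCorr_anisoHeis_eq_zero_comp`); Koma–Tasaki (`SU(2)`, hypothesis i) removed) turn it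
into `√3σ − ε ≤ m_Λ(B)` eventually, for every `B, ε > 0`; Mermin–Wagner (`sq_re_gibbsState_siteSpin_le_layeredHeis`) bounds
`m_Λ(B) ≤ √(c + c'B)` uniformly in `Λ`; `B, ε → 0` give `3σ² ≤ c`. [cite: MerminWagnerPRL1966, pp. 1133–1135]
[cite: KomaTasaki1993, Corollary 2.2 (2.18), §1 (1.7)–(1.8)] [cite: KleinLandauShucker1981] [cite: KLS1988JSP, eq. (5), (7)] -/
theorem layeredHeis_thermalNeelOrderParameter_liminf_le (hm1 : 1 ≤ m) (hm2 : m ≤ 2) (K : Fin (m + 1) → ℝ) (n : ℕ)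
    {β : ℝ} (hβ : 0 < β) {R : ℕ} (hR : 1 ≤ R) :
    liminf (fun k : ℕ =>
      (∑ x : TorusSite (m + 1) (2 * k + 2), ∑ y : TorusSite (m + 1) (2 * k + 2),
          (-1 : ℝ) ^ (∑ i, (x i).val) * (-1) ^ (∑ i, (y i).val) *
            ∑ α : Fin 3, gibbsSpinCorr β (heisAnisoTorus (2 * k + 2) n K) α x y) /
        ((2 * k + 2 : ℕ) : ℝ) ^ (2 * (m + 1))) atTop ≤
      β * ((n : ℝ) / 2) ^ 2 * (2 * ((n : ℝ) / 2) ^ 2 *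
        (16 * (∑ j : Fin m, |K (Fin.castSucc j)|) / (∑ k ∈ range R, (1 : ℝ) / (k + 1)) +
          8 * |K (Fin.last m)| * (R : ℝ) ^ 2)) := by
  set c : ℝ := β * ((n : ℝ) / 2) ^ 2 * (2 * ((n : ℝ) / 2) ^ 2 *
    (16 * (∑ j : Fin m, |K (Fin.castSucc j)|) / (∑ k ∈ range R, (1 : ℝ) / (k + 1)) +
      8 * |K (Fin.last m)| * (R : ℝ) ^ 2)) with hc
  set c' : ℝ := β * ((n : ℝ) / 2) ^ 2 * ((n : ℝ) / 2 * (4 * (R : ℝ) ^ 2)) with hc'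
  set G : ℕ → ℝ := fun k =>
    (∑ x : TorusSite (m + 1) (2 * k + 2), ∑ y : TorusSite (m + 1) (2 * k + 2),
        (-1 : ℝ) ^ (∑ i, (x i).val) * (-1) ^ (∑ i, (y i).val) *
          gibbsSpinCorr β (heisAnisoTorus (2 * k + 2) n K) 0 x y) / ((2 * k + 2 : ℕ) : ℝ) ^ (2 * (m + 1)) with hG
  set F : ℕ → ℝ := fun k =>
    (∑ x : TorusSite (m + 1) (2 * k + 2), ∑ y : TorusSite (m + 1) (2 * k + 2),
        (-1 : ℝ) ^ (∑ i, (x i).val) * (-1) ^ (∑ i, (y i).val) *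
          ∑ α : Fin 3, gibbsSpinCorr β (heisAnisoTorus (2 * k + 2) n K) α x y) /
      ((2 * k + 2 : ℕ) : ℝ) ^ (2 * (m + 1)) with hF
  have HRpos : 0 < ∑ k ∈ range R, (1 : ℝ) / (k + 1) := lt_of_lt_of_le one_pos (one_le_sum_range_one_div_succ hR)
  have hc0 : 0 ≤ c := by positivity
  have hc'0 : 0 ≤ c' := by positivity
  -- isotropy: the functional is three times the `Sˣ` moment
  have hFG : ∀ k, F k = 3 * G k := fun k => by
    simp only [hF, hG]
    rw [mul_div_assoc']
    congr 1
    rw [Finset.mul_sum]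
    refine sum_congr rfl fun x _ => ?_
    rw [Finset.mul_sum]
    refine sum_congr rfl fun y _ => ?_
    have h3 : ∑ α : Fin 3, gibbsSpinCorr β (heisAnisoTorus (2 * k + 2) n K) α x y =
        3 * gibbsSpinCorr β (heisAnisoTorus (2 * k + 2) n K) 0 x y := by
      rw [Finset.sum_congr rfl fun α _ => gibbsSpinCorr_anisoHeis_eq_zero_comp (2 * k + 2) n K β α x y, sum_const,
        card_univ, Fintype.card_fin, nsmul_eq_mul, Nat.cast_ofNat]
    rw [h3]
    ring
  -- the moment is nonnegative on the tori of side ≥ 4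
  have hG0 : ∀ k, 1 ≤ k → 0 ≤ G k := fun k hk => by
    have h := KomaTasaki.Z2System.moment_nonneg (XXZKT.anisoAfSU2System (m + 1) (2 * k + 2) n K).toZ2System β 1
    rw [XXZKT.anisoAfSU2System_moment_one (m + 1) (2 * k + 2) n (by omega) K β, card_torusSite_neel, Nat.cast_pow,
      ← pow_mul, mul_comm (m + 1) 2] at h
    simpa only [hG] using h
  by_contra hcon
  rw [not_le] at hcon
  have hbdd : IsBoundedUnder (· ≥ ·) atTop F := by
    refine ⟨0, ?_⟩
    rw [eventually_map]
    filter_upwards [eventually_ge_atTop 1] with k hk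
    show 0 ≤ F k
    rw [hFG]
    exact mul_nonneg (by norm_num) (hG0 k hk)
  set ℓ := liminf F atTop with hℓ
  have hev : ∀ᶠ k in atTop, (c + ℓ) / 2 < F k := eventually_lt_of_lt_liminf (by linarith) hbdd
  set σ : ℝ := Real.sqrt ((c + ℓ) / 2 / 3) with hσ
  have hσ0 : 0 ≤ σ := Real.sqrt_nonneg _
  have hσ2 : σ ^ 2 = (c + ℓ) / 2 / 3 := Real.sq_sqrt (by linarith)
  have hLRO : ∀ᶠ k : ℕ in atTop, σ ^ 2 ≤ G k := by
    filter_upwards [hev] with k hk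
    rw [hFG] at hk
    rw [hσ2]
    linarith
  -- Koma–Tasaki + Mermin–Wagner: `√3 σ − ε ≤ √(c + c' B)` for all `B, ε > 0`
  have hkey : ∀ B : ℝ, 0 < B → ∀ ε : ℝ, 0 < ε → Real.sqrt 3 * σ - ε ≤ Real.sqrt (c + c' * B) := by
    intro B hB ε hε
    have hKT := XXZKT.anisoHeis_thermal_stagMagnetisation_ge_of_eventually_sq_le (d := m + 1) (by omega) K hβ hσ0
      hLRO hB hε
    obtain ⟨k, hk, hk1⟩ := (hKT.and (eventually_ge_atTop 1)).exists
    refine hk.trans (XXZKT.inv_card_mul_re_stagSpin_le_sqrt n _ _ fun x => ?_)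
    have hmw := sq_re_gibbsState_siteSpin_le_layeredHeis (2 * k + 2) n hm1 hm2 (by omega) K
      (XXZKT.torusParityExp (m + 1) (2 * k + 2)) 0 B hβ.le hR x
    rw [abs_of_pos hB] at hmw
    refine hmw.trans (le_of_eq ?_)
    rw [hc, hc']
    ring
  -- hence `3σ² ≤ c`
  have h3 : 3 * σ ^ 2 ≤ c := by
    refine le_of_forall_pos_le_add fun ε hε => ?_
    have hB : 0 < ε / (c' + 1) := div_pos hε (by linarith)
    have h1 : Real.sqrt 3 * σ ≤ Real.sqrt (c + c' * (ε / (c' + 1))) :=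
      le_of_forall_pos_le_add fun ε' hε' => by linarith [hkey _ hB ε' hε']
    have h2 : (Real.sqrt 3 * σ) ^ 2 ≤ (Real.sqrt (c + c' * (ε / (c' + 1)))) ^ 2 :=
      pow_le_pow_left₀ (mul_nonneg (Real.sqrt_nonneg _) hσ0) h1 2
    rw [mul_pow, Real.sq_sqrt (by norm_num : (0 : ℝ) ≤ 3),
      Real.sq_sqrt (add_nonneg hc0 (mul_nonneg hc'0 hB.le))] at h2
    have h4 : c' * (ε / (c' + 1)) ≤ ε := by
      rw [mul_div_assoc', div_le_iff₀ (by linarith : (0 : ℝ) < c' + 1)]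
      nlinarith
    linarith
  rw [hσ2] at h3
  linarith

/-- **The three-dimensional layered antiferromagnet `K = (K₀, K₁, K_⊥)`**: for every spin, `β > 0`, `R ≥ 1`,
`liminf_k |Λ|⁻² Σ_{x,y}(-1)^{x+y}Σ_α Re⟨S^α_xS^α_y⟩_{β,H_K} ≤ β S²·2S²(16(|K₀|+|K₁|)/H_R + 8|K_⊥|R²)` on `(ℤ/(2k+2)ℤ)³`.
[cite: MerminWagnerPRL1966, pp. 1133–1135] [cite: KomaTasaki1993, Corollary 2.2] [cite: KLS1988JSP, eq. (5), (7)] -/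
theorem layeredHeis_thermalNeelOrderParameter_liminf_le_three (K : Fin 3 → ℝ) (n : ℕ) {β : ℝ} (hβ : 0 < β)
    {R : ℕ} (hR : 1 ≤ R) :
    liminf (fun k : ℕ =>
      (∑ x : TorusSite 3 (2 * k + 2), ∑ y : TorusSite 3 (2 * k + 2),
          (-1 : ℝ) ^ (∑ i, (x i).val) * (-1) ^ (∑ i, (y i).val) *
            ∑ α : Fin 3, gibbsSpinCorr β (heisAnisoTorus (2 * k + 2) n K) α x y) /
        ((2 * k + 2 : ℕ) : ℝ) ^ (2 * 3)) atTop ≤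
      β * ((n : ℝ) / 2) ^ 2 * (2 * ((n : ℝ) / 2) ^ 2 *
        (16 * (|K 0| + |K 1|) / (∑ k ∈ range R, (1 : ℝ) / (k + 1)) + 8 * |K 2| * (R : ℝ) ^ 2)) := by
  have h := layeredHeis_thermalNeelOrderParameter_liminf_le (m := 2) (by norm_num) le_rfl K n hβ hR
  simpa only [Fin.sum_univ_two, show Fin.castSucc (0 : Fin 2) = (0 : Fin 3) from rfl,
    show Fin.castSucc (1 : Fin 2) = (1 : Fin 3) from rfl, show Fin.last 2 = (2 : Fin 3) from rfl] using h

/-- **KENNEDY–LIEB–SHASTRY'S LAYERED MODEL `K = (1, 1, r)`, TWO-SIDED** (`0 < r ≤ 1`, every spin `S = n/2`, every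
`β > 0`, every `R ≥ 1`): the thermal Néel order parameter along the even tori `(ℤ/(2k+2)ℤ)³` is sandwiched,
`S(S+1) − 9S/√2 − 3C(r)/(2β) ≤ liminf_k |Λ|⁻² Σ_{x,y}(-1)^{x+y}⟨𝐒_x·𝐒_y⟩_β ≤ 2βS⁴(32/H_R + 8rR²)` —
reflection positivity (the tree's `layeredHeis_thermalNeelOrderParameter_ge`, `C(r) = AnisotropicRotator.klsConstant r
≤ 3 + log(1/r)`) below, Mermin–Wagner–Koma–Tasaki above. [cite: KLS1988JSP, p. 1020, eqs. (5), (7)] [cite: DLS1978, Thm. 6.2]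
[cite: MerminWagnerPRL1966, pp. 1133–1135] [cite: KomaTasaki1993, Corollary 2.2] -/
theorem layeredHeis_thermalNeelOrderParameter_two_sided {r : ℝ} (hr0 : 0 < r) (hr1 : r ≤ 1) (n : ℕ) {β : ℝ}
    (hβ : 0 < β) {R : ℕ} (hR : 1 ≤ R) :
    (n : ℝ) / 2 * ((n : ℝ) / 2 + 1) - 9 * ((n : ℝ) / 2) / Real.sqrt 2 -
          3 * AnisotropicRotator.klsConstant r / (2 * β) ≤
        liminf (fun k : ℕ =>
          (∑ x : TorusSite 3 (2 * k + 2), ∑ y : TorusSite 3 (2 * k + 2),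
              (-1 : ℝ) ^ (∑ i, (x i).val) * (-1) ^ (∑ i, (y i).val) *
                ∑ α : Fin 3, gibbsSpinCorr β (heisAnisoTorus (2 * k + 2) n ![(1 : ℝ), 1, r]) α x y) /
            ((2 * k + 2 : ℕ) : ℝ) ^ (2 * 3)) atTop ∧
      liminf (fun k : ℕ =>
          (∑ x : TorusSite 3 (2 * k + 2), ∑ y : TorusSite 3 (2 * k + 2),
              (-1 : ℝ) ^ (∑ i, (x i).val) * (-1) ^ (∑ i, (y i).val) *
                ∑ α : Fin 3, gibbsSpinCorr β (heisAnisoTorus (2 * k + 2) n ![(1 : ℝ), 1, r]) α x y) /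
            ((2 * k + 2 : ℕ) : ℝ) ^ (2 * 3)) atTop ≤
        2 * β * ((n : ℝ) / 2) ^ 4 * (32 / (∑ k ∈ range R, (1 : ℝ) / (k + 1)) + 8 * r * (R : ℝ) ^ 2) := by
  refine ⟨layeredHeis_thermalNeelOrderParameter_ge hr0 hr1 n hβ, ?_⟩
  have h := layeredHeis_thermalNeelOrderParameter_liminf_le_three ![(1 : ℝ), 1, r] n hβ hR
  have e0 : (![(1 : ℝ), 1, r]) 0 = 1 := rfl
  have e1 : (![(1 : ℝ), 1, r]) 1 = 1 := rfl
  have e2 : (![(1 : ℝ), 1, r]) 2 = r := rfl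
  rw [e0, e1, e2, abs_one, abs_of_pos hr0] at h
  refine h.trans (le_of_eq ?_)
  ring

/-- **THE `1/log(1/r)` CEILING** (Kennedy–Lieb–Shastry's layered model, `0 < r < 1`, every spin, every `β > 0`):
`liminf_k |Λ|⁻² Σ_{x,y}(-1)^{x+y}⟨𝐒_x·𝐒_y⟩_β ≤ 320 β S⁴/log(1/r)` (the scale `R = ⌊r^{-1/4}⌋`: `rR⁴ ≤ 1`,
`H_R ≥ log(R+1) ≥ ¼ log(1/r)`). Read with the tree's floor (Néel order once `2β(S(S+1) − 9S/√2) > 3(3 + log(1/r))`,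
`layeredHeis_neelLRO_thermal_largeSpin`): a thermal Néel order parameter of size `m₀²` in weakly coupled Heisenberg layers
exists only for `β ≥ m₀² log(1/r)/(320 S⁴)` and does exist (large spin) for `β ≥ 3(3 + log(1/r))/(2(S(S+1) − 9S/√2))` —
the Néel temperature of the quasi-two-dimensional antiferromagnet is pinned to the window `Θ(1/log(1/r))` by theorems on
both sides. [cite: MerminWagnerPRL1966, pp. 1133–1135] [cite: KomaTasaki1993, Corollary 2.2]
[cite: KLS1988JSP, p. 1020, eqs. (5), (7)] [cite: KleinLandauShucker1981] -/
theorem layeredHeis_thermalNeelOrderParameter_liminf_le_log {r : ℝ} (hr0 : 0 < r) (hr1 : r < 1) (n : ℕ) {β : ℝ}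
    (hβ : 0 < β) :
    liminf (fun k : ℕ =>
        (∑ x : TorusSite 3 (2 * k + 2), ∑ y : TorusSite 3 (2 * k + 2),
            (-1 : ℝ) ^ (∑ i, (x i).val) * (-1) ^ (∑ i, (y i).val) *
              ∑ α : Fin 3, gibbsSpinCorr β (heisAnisoTorus (2 * k + 2) n ![(1 : ℝ), 1, r]) α x y) /
          ((2 * k + 2 : ℕ) : ℝ) ^ (2 * 3)) atTop ≤
      320 * β * ((n : ℝ) / 2) ^ 4 / Real.log (1 / r) := by
  -- the scale `R = ⌊(1/r)^{1/4}⌋`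
  set t : ℝ := Real.sqrt (Real.sqrt (1 / r)) with ht
  have hr1' : 1 < 1 / r := by rw [lt_div_iff₀ hr0]; linarith
  have ht1 : 1 ≤ t := Real.one_le_sqrt.2 (Real.one_le_sqrt.2 hr1'.le)
  have ht0 : 0 < t := one_pos.trans_le ht1
  have ht4 : t ^ 4 = 1 / r := by
    rw [show t ^ 4 = (t ^ 2) ^ 2 by ring, ht, Real.sq_sqrt (Real.sqrt_nonneg _), Real.sq_sqrt (by positivity)]
  set R : ℕ := ⌊t⌋₊ with hRdef
  have hR1 : 1 ≤ R := Nat.floor_pos.2 ht1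
  have hRt : (R : ℝ) ≤ t := Nat.floor_le ht0.le
  have htR : t < (R : ℝ) + 1 := Nat.lt_floor_add_one t
  have hR0 : (0 : ℝ) < R := by exact_mod_cast hR1
  have hrR4 : r * (R : ℝ) ^ 4 ≤ 1 := by
    have h1 : (R : ℝ) ^ 4 ≤ t ^ 4 := pow_le_pow_left₀ hR0.le hRt 4
    rw [ht4] at h1
    calc r * (R : ℝ) ^ 4 ≤ r * (1 / r) := mul_le_mul_of_nonneg_left h1 hr0.le
      _ = 1 := by field_simp
  set H : ℝ := ∑ k ∈ range R, (1 : ℝ) / (k + 1) with hH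
  have hH1 : 1 ≤ H := one_le_sum_range_one_div_succ hR1
  have hH0 : 0 < H := by linarith
  have hHR : H ≤ (R : ℝ) := by
    have h1 : ∀ k ∈ range R, (1 : ℝ) / (k + 1) ≤ 1 := fun k _ => by
      rw [div_le_one (by positivity)]
      have := (Nat.cast_nonneg k : (0 : ℝ) ≤ k)
      linarith
    calc H ≤ ∑ _k ∈ range R, (1 : ℝ) := sum_le_sum h1
      _ = R := by rw [sum_const, card_range, nsmul_eq_mul, mul_one]
  -- `8 r R² ≤ 8/H_R`
  have hrR2 : r * (R : ℝ) ^ 2 ≤ 1 / H := by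
    rw [le_div_iff₀ hH0]
    calc r * (R : ℝ) ^ 2 * H ≤ r * (R : ℝ) ^ 2 * (R : ℝ) ^ 2 := by
          refine mul_le_mul_of_nonneg_left (hHR.trans ?_) (by positivity)
          nlinarith
      _ = r * (R : ℝ) ^ 4 := by ring
      _ ≤ 1 := hrR4
  -- `log(1/r)/4 ≤ log(R+1) ≤ H_R`
  have hlog : Real.log (1 / r) / 4 ≤ H := by
    have h1 : Real.log t = Real.log (1 / r) / 4 := by
      rw [ht, Real.log_sqrt (Real.sqrt_nonneg _), Real.log_sqrt (by positivity)]
      ring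
    have h2 : Real.log t ≤ Real.log ((R : ℝ) + 1) := Real.log_le_log ht0 htR.le
    linarith [log_succ_le_harmonicSum_neel R]
  have hlog0 : 0 < Real.log (1 / r) := Real.log_pos hr1'
  have hmain := (layeredHeis_thermalNeelOrderParameter_two_sided hr0 hr1.le n hβ hR1).2
  refine hmain.trans ?_
  have hS : 0 ≤ 2 * β * ((n : ℝ) / 2) ^ 4 := by positivity
  calc 2 * β * ((n : ℝ) / 2) ^ 4 * (32 / H + 8 * r * (R : ℝ) ^ 2)
      ≤ 2 * β * ((n : ℝ) / 2) ^ 4 * (40 / H) := by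
        refine mul_le_mul_of_nonneg_left ?_ hS
        have : 8 * r * (R : ℝ) ^ 2 ≤ 8 * (1 / H) := by linarith [hrR2]
        rw [show (40 : ℝ) / H = 32 / H + 8 * (1 / H) by ring]
        linarith
    _ = 80 * β * ((n : ℝ) / 2) ^ 4 / H := by ring
    _ ≤ 80 * β * ((n : ℝ) / 2) ^ 4 / (Real.log (1 / r) / 4) :=
        div_le_div_of_nonneg_left (by positivity) (by positivity) hlog
    _ = 320 * β * ((n : ℝ) / 2) ^ 4 / Real.log (1 / r) := by
        field_simp
        ring

end NeelCeiling

end Literature.MathematicalPhysics.QuantumLattice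

end
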